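import Mathlib
import Summits.AtomisticToContinuum.Crystallization.Theorems.BraggSlacknessRigidityHcpDiffractionRigidityEssentialPeriodicityRatAux2

/-!
# Gaussian-tested intensities of a separated set: passage to `Λ` and the main inequality
# (stub `stub_essentialPeriodicityRat` of crux `HcpDiffractionRigidity`,
# item `stmt-AtomisticToContinuum-13166`, Aux file 3)

Let `Λ ⊆ ℝ³` be `r`-separated, `c ≥ 0` weights summable over `Λ`, `S = ∑' c(s) e^{2πi⟨ξ,s⟩}` the
weighted structure factor, `MG = ∑' c²`, `BAD(z₀) = ∑'_{s+z₀ ∉ Λ} c(s)²` and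
`τ(r,A) = e^{-πA²r²/2} · 2(2/r+1)³(8/A²+1)³`. Passing to `Λ` in the finite pair-correlation bound
(Aux file 2) with the modulated Gaussian identity and truncation (Aux file 1):

* `tsum_sq_le_integral_gauss_normSq`, `integral_gauss_normSq_le` —
  `A³ MG ≤ ∫ e^{-π|ξ|²/A²}|S|² ≤ A³(1+τ) MG`;
* `integral_gauss_cos_normSq_le` — if `|p - q - z₀| ≥ r` for `p, q ∈ Λ`, `p - q ≠ z₀`:
  `∫ e^{-π|ξ|²/A²} cos(2π⟨ξ,z₀⟩)|S|² ≤ A³(½ ∑' 1[s-z₀ ∈ Λ]c² + ½ ∑' 1[s+z₀ ∈ Λ]c² + τ MG)`;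
* `integral_gauss_one_sub_cos_normSq_ge` — the MAIN INEQUALITY
  `A³(½ BAD(z₀) - τ MG) ≤ ∫ e^{-π|ξ|²/A²}(1 - cos 2π⟨ξ,z₀⟩)|S|²`.

All `[folklore]`.
-/

noncomputable section

namespace Summit.AtomisticToContinuum.Crystallization.Theorems

namespace HcpRigiditySpectral

open MeasureTheory Complex Filter Metric Set
open scoped BigOperators Real RealInnerProductSpace ComplexConjugate Topology Classical
open Summit.AtomisticToContinuum.Crystallization.Theorems.HcpRigidityDenseCentres
open Summit.AtomisticToContinuum.Crystallization.Theorems.HcpRigidityWindows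
open Summit.AtomisticToContinuum.Crystallization.Theorems.HcpRigidityLocalLimit

/-! ## Passage to `Λ` -/

/-- **Lower Gaussian bound.** `A³ ∑' c² ≤ ∫ e^{-π|ξ|²/A²} |S|²` (the diagonal of the identity, and
truncation). [folklore] -/
theorem tsum_sq_le_integral_gauss_normSq {Λ : Set (EuclideanSpace ℝ (Fin 3))} {r : ℝ} (hr : 0 < r)
    (hΛ : ∀ p ∈ Λ, ∀ q ∈ Λ, p ≠ q → r ≤ dist p q) {A : ℝ} (hA : 0 < A)
    {c : EuclideanSpace ℝ (Fin 3) → ℝ} (hc0 : ∀ z, 0 ≤ c z) (hcs : Summable fun s : Λ => c s) :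
    A ^ 3 * ∑' s : Λ, c s ^ 2 ≤
      ∫ ξ : EuclideanSpace ℝ (Fin 3), Real.exp (-(Real.pi / A ^ 2) * ‖ξ‖ ^ 2) *
        ‖∑' s : Λ, (c s : ℂ) * cexp (2 * Real.pi * I * (⟪ξ, (s : EuclideanSpace ℝ (Fin 3))⟫ : ℂ))‖ ^ 2 := by
  have hlimR := tendsto_integral_truncation hr hΛ hc0 hcs
    (integrable_rexp_neg_mul_sq_norm (b := Real.pi / A ^ 2) (by positivity))
  have hlimL : Tendsto (fun n : ℕ => A ^ 3 * ∑ s ∈ (finite_norm_le hr hΛ (n : ℝ)).toFinset, c s ^ 2)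
      atTop (𝓝 (A ^ 3 * ∑' s : Λ, c s ^ 2)) :=
    (tendsto_sum_truncation hr hΛ (summable_sq_of_summable hc0 hcs)).const_mul _
  refine le_of_tendsto_of_tendsto' hlimL hlimR fun n => ?_
  set T := (finite_norm_le hr hΛ (n : ℝ)).toFinset with hT
  have hid := integral_gauss_cos_normSq_window T c hA 0
  simp only [inner_zero_right, mul_zero, Real.cos_zero, mul_one, sub_zero] at hid
  rw [hid, Finset.mul_sum]
  refine Finset.sum_le_sum fun s hs => ?_
  have hdiag : A ^ 3 * c s ^ 2 = c s * c s * (A ^ 3 *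
      Real.exp (-(Real.pi * A ^ 2 * ‖(s : EuclideanSpace ℝ (Fin 3)) - s‖ ^ 2))) := by
    rw [sub_self, norm_zero]; simp; ring
  rw [hdiag]
  exact Finset.single_le_sum (f := fun s' : Λ => c s * c s' * (A ^ 3 *
    Real.exp (-(Real.pi * A ^ 2 * ‖(s : EuclideanSpace ℝ (Fin 3)) - s'‖ ^ 2))))
    (fun s' _ => mul_nonneg (mul_nonneg (hc0 _) (hc0 _)) (by positivity)) hs

/-- The modulated Gaussian test function `e^{-π|ξ|²/A²} cos(2π⟨ξ,z₀⟩)` is integrable. [folklore] -/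
theorem integrable_gauss_cos {A : ℝ} (hA : 0 < A) (z₀ : EuclideanSpace ℝ (Fin 3)) :
    Integrable fun ξ : EuclideanSpace ℝ (Fin 3) =>
      Real.exp (-(Real.pi / A ^ 2) * ‖ξ‖ ^ 2) * Real.cos (2 * Real.pi * ⟪ξ, z₀⟫) := by
  refine (integrable_rexp_neg_mul_sq_norm (b := Real.pi / A ^ 2) (by positivity)).mul_bdd (c := 1)
    (Continuous.aestronglyMeasurable (by fun_prop)) (ae_of_all _ fun ξ => ?_)
  rw [Real.norm_eq_abs]
  exact Real.abs_cos_le_one _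

/-- **Modulated Gaussian bound.** If `|p - q - z₀| ≥ r` for all `p, q ∈ Λ` with `p - q ≠ z₀`, then
`∫ e^{-π|ξ|²/A²} cos(2π⟨ξ,z₀⟩)|S|² ≤
A³ (½ ∑' 1[s-z₀ ∈ Λ] c² + ½ ∑' 1[s+z₀ ∈ Λ] c² + τ(r,A) ∑' c²)`. [folklore] -/
theorem integral_gauss_cos_normSq_le {Λ : Set (EuclideanSpace ℝ (Fin 3))} {r : ℝ} (hr : 0 < r)
    (hΛ : ∀ p ∈ Λ, ∀ q ∈ Λ, p ≠ q → r ≤ dist p q) {A : ℝ} (hA : 0 < A)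
    {c : EuclideanSpace ℝ (Fin 3) → ℝ} (hc0 : ∀ z, 0 ≤ c z) (hcs : Summable fun s : Λ => c s)
    {z₀ : EuclideanSpace ℝ (Fin 3)} (hz₀ : ∀ p ∈ Λ, ∀ q ∈ Λ, p - q - z₀ ≠ 0 → r ≤ ‖p - q - z₀‖) :
    ∫ ξ : EuclideanSpace ℝ (Fin 3), Real.exp (-(Real.pi / A ^ 2) * ‖ξ‖ ^ 2) * Real.cos (2 * Real.pi * ⟪ξ, z₀⟫) *
        ‖∑' s : Λ, (c s : ℂ) * cexp (2 * Real.pi * I * (⟪ξ, (s : EuclideanSpace ℝ (Fin 3))⟫ : ℂ))‖ ^ 2 ≤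
      A ^ 3 * ((∑' s : Λ, if (s : EuclideanSpace ℝ (Fin 3)) - z₀ ∈ Λ then c s ^ 2 else 0) / 2 +
        (∑' s : Λ, if (s : EuclideanSpace ℝ (Fin 3)) + z₀ ∈ Λ then c s ^ 2 else 0) / 2 +
        Real.exp (-(Real.pi * A ^ 2 * r ^ 2 / 2)) * (2 * (2 / r + 1) ^ 3 * (8 / A ^ 2 + 1) ^ 3) *
          ∑' s : Λ, c s ^ 2) := by
  have hlim := tendsto_integral_truncation hr hΛ hc0 hcs (integrable_gauss_cos hA z₀)
  refine le_of_tendsto' hlim fun n => ?_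
  set T := (finite_norm_le hr hΛ (n : ℝ)).toFinset with hT
  have hid := integral_gauss_cos_normSq_window T c hA z₀
  rw [hid]
  refine (sum_sum_gauss_le hr hΛ hA c T hz₀).trans ?_
  have hτ0 : 0 ≤ Real.exp (-(Real.pi * A ^ 2 * r ^ 2 / 2)) * (2 * (2 / r + 1) ^ 3 * (8 / A ^ 2 + 1) ^ 3) := by
    positivity
  gcongr
  · exact (summable_ite_sq hc0 hcs _).sum_le_tsum T fun s _ => by positivity
  · exact (summable_ite_sq hc0 hcs _).sum_le_tsum T fun s _ => by positivity
  · exact (summable_sq_of_summable hc0 hcs).sum_le_tsum T fun s _ => by positivity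

/-- **Upper Gaussian bound.** `∫ e^{-π|ξ|²/A²}|S|² ≤ A³ (1 + τ(r,A)) ∑' c²`. [folklore] -/
theorem integral_gauss_normSq_le {Λ : Set (EuclideanSpace ℝ (Fin 3))} {r : ℝ} (hr : 0 < r)
    (hΛ : ∀ p ∈ Λ, ∀ q ∈ Λ, p ≠ q → r ≤ dist p q) {A : ℝ} (hA : 0 < A)
    {c : EuclideanSpace ℝ (Fin 3) → ℝ} (hc0 : ∀ z, 0 ≤ c z) (hcs : Summable fun s : Λ => c s) :
    ∫ ξ : EuclideanSpace ℝ (Fin 3), Real.exp (-(Real.pi / A ^ 2) * ‖ξ‖ ^ 2) *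
        ‖∑' s : Λ, (c s : ℂ) * cexp (2 * Real.pi * I * (⟪ξ, (s : EuclideanSpace ℝ (Fin 3))⟫ : ℂ))‖ ^ 2 ≤
      A ^ 3 * (1 + Real.exp (-(Real.pi * A ^ 2 * r ^ 2 / 2)) * (2 * (2 / r + 1) ^ 3 * (8 / A ^ 2 + 1) ^ 3)) *
        ∑' s : Λ, c s ^ 2 := by
  have h := integral_gauss_cos_normSq_le hr hΛ hA hc0 hcs (z₀ := 0) fun p hp q hq hpq => by
    rw [sub_zero] at hpq ⊢
    rw [← dist_eq_norm]
    exact hΛ p hp q hq (sub_ne_zero.1 hpq)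
  have h1 : (∑' s : Λ, if (s : EuclideanSpace ℝ (Fin 3)) - 0 ∈ Λ then c s ^ 2 else 0) =
      ∑' s : Λ, c s ^ 2 := tsum_congr fun s => by rw [sub_zero, if_pos s.2]
  have h2 : (∑' s : Λ, if (s : EuclideanSpace ℝ (Fin 3)) + 0 ∈ Λ then c s ^ 2 else 0) =
      ∑' s : Λ, c s ^ 2 := tsum_congr fun s => by rw [add_zero, if_pos s.2]
  have h3 : ∫ ξ : EuclideanSpace ℝ (Fin 3), Real.exp (-(Real.pi / A ^ 2) * ‖ξ‖ ^ 2) *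
      Real.cos (2 * Real.pi * ⟪ξ, (0 : EuclideanSpace ℝ (Fin 3))⟫) *
        ‖∑' s : Λ, (c s : ℂ) * cexp (2 * Real.pi * I * (⟪ξ, (s : EuclideanSpace ℝ (Fin 3))⟫ : ℂ))‖ ^ 2 =
      ∫ ξ : EuclideanSpace ℝ (Fin 3), Real.exp (-(Real.pi / A ^ 2) * ‖ξ‖ ^ 2) *
        ‖∑' s : Λ, (c s : ℂ) * cexp (2 * Real.pi * I * (⟪ξ, (s : EuclideanSpace ℝ (Fin 3))⟫ : ℂ))‖ ^ 2 :=
    integral_congr_ae (ae_of_all _ fun ξ => by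
      simp only [inner_zero_right, mul_zero, Real.cos_zero, mul_one])
  rw [h1, h2, h3] at h
  linarith

/-- `BAD(z₀) + GOOD(z₀) = MG`. [folklore] -/
theorem tsum_ite_add_tsum_ite {Λ : Set (EuclideanSpace ℝ (Fin 3))} {c : EuclideanSpace ℝ (Fin 3) → ℝ}
    (hc0 : ∀ z, 0 ≤ c z) (hcs : Summable fun s : Λ => c s) (z₀ : EuclideanSpace ℝ (Fin 3)) :
    (∑' s : Λ, if (s : EuclideanSpace ℝ (Fin 3)) + z₀ ∈ Λ then c s ^ 2 else 0) +
      (∑' s : Λ, if (s : EuclideanSpace ℝ (Fin 3)) + z₀ ∈ Λ then (0 : ℝ) else c s ^ 2) = ∑' s : Λ, c s ^ 2 := by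
  rw [← (summable_ite_sq hc0 hcs _).tsum_add (summable_ite_zero_sq hc0 hcs _)]
  exact tsum_congr fun s => by split_ifs <;> simp

/-- **Main inequality.** Let `Λ ⊆ ℝ³` be `r`-separated, `c ≥ 0` summable weights, `A > 0`, and
`z₀` with `|p - q - z₀| ≥ r` for all `p, q ∈ Λ`, `p - q ≠ z₀`. Then
`A³ (½ BAD(z₀) - τ(r,A) MG) ≤ ∫ e^{-π|ξ|²/A²} (1 - cos 2π⟨ξ,z₀⟩) |S|²`,
`BAD(z₀) = ∑'_{s+z₀ ∉ Λ} c(s)²`, `MG = ∑' c²`. [folklore] -/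
theorem integral_gauss_one_sub_cos_normSq_ge {Λ : Set (EuclideanSpace ℝ (Fin 3))} {r : ℝ} (hr : 0 < r)
    (hΛ : ∀ p ∈ Λ, ∀ q ∈ Λ, p ≠ q → r ≤ dist p q) {A : ℝ} (hA : 0 < A)
    {c : EuclideanSpace ℝ (Fin 3) → ℝ} (hc0 : ∀ z, 0 ≤ c z) (hcs : Summable fun s : Λ => c s)
    {z₀ : EuclideanSpace ℝ (Fin 3)} (hz₀ : ∀ p ∈ Λ, ∀ q ∈ Λ, p - q - z₀ ≠ 0 → r ≤ ‖p - q - z₀‖) :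
    A ^ 3 * ((∑' s : Λ, if (s : EuclideanSpace ℝ (Fin 3)) + z₀ ∈ Λ then (0 : ℝ) else c s ^ 2) / 2 -
        Real.exp (-(Real.pi * A ^ 2 * r ^ 2 / 2)) * (2 * (2 / r + 1) ^ 3 * (8 / A ^ 2 + 1) ^ 3) *
          ∑' s : Λ, c s ^ 2) ≤
      ∫ ξ : EuclideanSpace ℝ (Fin 3), Real.exp (-(Real.pi / A ^ 2) * ‖ξ‖ ^ 2) * (1 - Real.cos (2 * Real.pi * ⟪ξ, z₀⟫)) *
        ‖∑' s : Λ, (c s : ℂ) * cexp (2 * Real.pi * I * (⟪ξ, (s : EuclideanSpace ℝ (Fin 3))⟫ : ℂ))‖ ^ 2 := by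
  have hlow := tsum_sq_le_integral_gauss_normSq hr hΛ hA hc0 hcs
  have hup := integral_gauss_cos_normSq_le hr hΛ hA hc0 hcs hz₀
  have hX : (∑' s : Λ, if (s : EuclideanSpace ℝ (Fin 3)) - z₀ ∈ Λ then c s ^ 2 else 0) ≤ ∑' s : Λ, c s ^ 2 :=
    (summable_ite_sq hc0 hcs _).tsum_le_tsum (fun s => by split_ifs <;> simp [sq_nonneg])
      (summable_sq_of_summable hc0 hcs)
  have hY := tsum_ite_add_tsum_ite hc0 hcs z₀
  have hint1 := integrable_mul_normSq_tsum hc0 hcs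
    (integrable_rexp_neg_mul_sq_norm (b := Real.pi / A ^ 2) (by positivity))
  have hint2 := integrable_mul_normSq_tsum hc0 hcs (integrable_gauss_cos hA z₀)
  have hsplit : ∫ ξ : EuclideanSpace ℝ (Fin 3), Real.exp (-(Real.pi / A ^ 2) * ‖ξ‖ ^ 2) *
      (1 - Real.cos (2 * Real.pi * ⟪ξ, z₀⟫)) *
        ‖∑' s : Λ, (c s : ℂ) * cexp (2 * Real.pi * I * (⟪ξ, (s : EuclideanSpace ℝ (Fin 3))⟫ : ℂ))‖ ^ 2 =
      (∫ ξ : EuclideanSpace ℝ (Fin 3), Real.exp (-(Real.pi / A ^ 2) * ‖ξ‖ ^ 2) *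
        ‖∑' s : Λ, (c s : ℂ) * cexp (2 * Real.pi * I * (⟪ξ, (s : EuclideanSpace ℝ (Fin 3))⟫ : ℂ))‖ ^ 2) -
      ∫ ξ : EuclideanSpace ℝ (Fin 3), Real.exp (-(Real.pi / A ^ 2) * ‖ξ‖ ^ 2) * Real.cos (2 * Real.pi * ⟪ξ, z₀⟫) *
        ‖∑' s : Λ, (c s : ℂ) * cexp (2 * Real.pi * I * (⟪ξ, (s : EuclideanSpace ℝ (Fin 3))⟫ : ℂ))‖ ^ 2 := by
    rw [← integral_sub hint1 hint2]
    exact integral_congr_ae (ae_of_all _ fun ξ => by ring)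
  rw [hsplit]
  have hA3 : 0 < A ^ 3 := by positivity
  have h1 : A ^ 3 * ((∑' s : Λ, if (s : EuclideanSpace ℝ (Fin 3)) - z₀ ∈ Λ then c s ^ 2 else 0) / 2 +
      (∑' s : Λ, if (s : EuclideanSpace ℝ (Fin 3)) + z₀ ∈ Λ then c s ^ 2 else 0) / 2 +
        Real.exp (-(Real.pi * A ^ 2 * r ^ 2 / 2)) * (2 * (2 / r + 1) ^ 3 * (8 / A ^ 2 + 1) ^ 3) *
          ∑' s : Λ, c s ^ 2) ≤
      A ^ 3 * ((∑' s : Λ, c s ^ 2) / 2 +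
        ((∑' s : Λ, c s ^ 2) - ∑' s : Λ, if (s : EuclideanSpace ℝ (Fin 3)) + z₀ ∈ Λ then (0 : ℝ) else c s ^ 2) / 2 +
        Real.exp (-(Real.pi * A ^ 2 * r ^ 2 / 2)) * (2 * (2 / r + 1) ^ 3 * (8 / A ^ 2 + 1) ^ 3) *
          ∑' s : Λ, c s ^ 2) :=
    mul_le_mul_of_nonneg_left (by linarith) hA3.le
  linarith [hlow, hup, h1]

end HcpRigiditySpectral

open scoped Classical

/-- **Registered helper stub of `stub_essentialPeriodicityRat` (Aux file 3): the main
pair-correlation inequality.** For an `r`-separated `Λ ⊆ ℝ³`, non-negative summable weights `c`,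
`A > 0` and `z₀` with `|p - q - z₀| ≥ r` for all `p, q ∈ Λ`, `p - q ≠ z₀`:
`A³ (½ ∑'_{s+z₀ ∉ Λ} c(s)² - τ(r,A) ∑' c²) ≤ ∫ e^{-π|ξ|²/A²} (1 - cos 2π⟨ξ,z₀⟩) |∑' c(s)e^{2πi⟨ξ,s⟩}|² dξ`,
`τ(r,A) = e^{-πA²r²/2} · 2(2/r+1)³(8/A²+1)³`. [folklore] -/
theorem stub_essentialPeriodicityRatMainIneq : ∀ (r : ℝ), 0 < r → ∀ Λ : Set (EuclideanSpace ℝ (Fin 3)), (∀ p ∈ Λ, ∀ q ∈ Λ, p ≠ q → r ≤ dist p q) → ∀ (A : ℝ), 0 < A → ∀ c : EuclideanSpace ℝ (Fin 3) → ℝ, (∀ z, 0 ≤ c z) → Summable (fun s : Λ => c (s : EuclideanSpace ℝ (Fin 3))) → ∀ z₀ : EuclideanSpace ℝ (Fin 3), (∀ p ∈ Λ, ∀ q ∈ Λ, p - q - z₀ ≠ 0 → r ≤ ‖p - q - z₀‖) → A ^ 3 * ((∑' s : Λ, if (s : EuclideanSpace ℝ (Fin 3)) + z₀ ∈ Λ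 then (0 : ℝ) else c (s : EuclideanSpace ℝ (Fin 3)) ^ 2) / 2 - Real.exp (-(Real.pi * A ^ 2 * r ^ 2 / 2)) * (2 * (2 / r + 1) ^ 3 * (8 / A ^ 2 + 1) ^ 3) * ∑' s : Λ, c (s : EuclideanSpace ℝ (Fin 3)) ^ 2) ≤ ∫ ξ : EuclideanSpace ℝ (Fin 3), Real.exp (-(Real.pi / A ^ 2) * ‖ξ‖ ^ 2) * (1 - Real.cos (2 * Real.pi * inner ℝ ξ z₀)) * ‖∑' s : Λ, (c (s : EuclideanSpace ℝ (Fin 3)) : ℂ) * Complex.exp (2 * Real.pi * Complex.I * (inner ℝ ξ (s : EuclideanSpace ℝ (Fin 3)) : ℂ))‖ ^ 2 :=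
  fun _ hr _ hΛ _ hA _ hc0 hcs _ hz₀ =>
    HcpRigiditySpectral.integral_gauss_one_sub_cos_normSq_ge hr hΛ hA hc0 hcs hz₀

end Summit.AtomisticToContinuum.Crystallization.Theorems

end
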